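import Literature.NumberTheory.LFunctions.ZetaMulAbelTransform
import Mathlib.Analysis.SumIntegralComparisons
import Mathlib.Analysis.SpecialFunctions.Integrals.Basic
import HarnessLib

/-!
# The harmonic sums of `ζ ⋆ χ` at a real zero: `∑_{n ≤ z} r(n)/n ≥ (2/5) L(1,χ)/δ − 13 q z^{-1/2}`

Topic `Literature/NumberTheory/LFunctions`. Everything in this file is PROVED.

Let `χ ≠ 1` be quadratic mod `q`, `r = ζ ⋆ χ ≥ 0`, `L₁ = L(1, χ) > 0`, and suppose `L(1 − δ, χ) = 0`
with `0 < δ ≤ 1/10`. From `ZetaMulAbelTransform.lean`: the real series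
`Ψ = ∑_{n ≥ 1} E(n)(n^{-β} − (n+1)^{-β})`, `β = 1 − δ`, `E(N) = ∑_{n ≤ N} r(n) − N L₁`, satisfies
`Ψ ≥ β L₁/δ`. Splitting at `z` (a natural number with `δ log z ≤ 1/2`):

* tail: `|E(n)| ≤ 5q√n` and `0 ≤ n^{-β} − (n+1)^{-β} ≤ β n^{-β-1}` give
  `|∑_{n > z} …| ≤ 5q ∑_{n > z} n^{-3/2+δ} ≤ 5q z^{-(1/2−δ)}/(1/2 − δ) ≤ (25/2) q z^{δ − 1/2}`;
* head: `E(n) = S₀(n) − n L₁` and `(n L₁)(n^{-β} − (n+1)^{-β}) ≥ 0`, so by Abel summation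
  `∑_{n ≤ z} E(n)(…) ≤ ∑_{n ≤ z} S₀(n)(n^{-β} − (n+1)^{-β}) = ∑_{k ≤ z} r(k) k^{-β} − S₀(z)(z+1)^{-β}
  ≤ z^{δ} ∑_{k ≤ z} r(k)/k`.

Hence `β L₁/δ ≤ z^δ G(z) + (25/2) q z^{δ−1/2}` with `G(z) = ∑_{k ≤ z} r(k)/k`, and since
`z^{-δ} ≥ e^{-1/2} ≥ 1/2`, `β ≥ 9/10`:

  `G(z) ≥ (2/5) L₁/δ − 13 q z^{-1/2}`   (`harmSum_ge`).

This is the tree's quantitative form of "`G(z) ≫ L(1,χ)/δ`", the lower bound for the Selberg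
denominator in step (3) of Motohashi's proof of his theorem on the Brun–Titchmarsh constant and
Siegel zeros (`Literature/Barriers/Parity/BrunTitchmarshSiegelZero.lean`); the sieve step consumes it
in `Literature/NumberTheory/Sieve/ZetaMulSelbergSieve.lean`.

## References

* Y. Motohashi, *A note on Siegel's zeros*, Proc. Japan Acad. 55A (1979) 190–192, proof of the
  Theorem, (3) (via [4, §4] there). [cite: Motohashi1979SiegelZeros, proof of the Theorem, (3)]
* H. L. Montgomery, R. C. Vaughan, *Multiplicative Number Theory I*, §1.3 Thm. 1.3 (Abel summation).
  [cite: MontgomeryVaughan2007, §1.3 Thm. 1.3]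
-/

noncomputable section

open Filter Topology Finset MeasureTheory
open scoped ComplexOrder

namespace Literature.NumberTheory.LFunctions.ZetaMul

variable {q : ℕ} (χ : DirichletCharacter ℂ q)

/-! ### The harmonic sum `G(z) = ∑_{k ≤ z} r(k)/k` -/

/-- `harmSum χ z = G(z) = ∑_{0 < k ≤ z} r(k)/k`. [folklore] -/
def harmSum (z : ℕ) : ℝ := ∑ k ∈ Ioc 0 z, coeff χ k / k

/-- `G(z) ≥ 0`. [folklore] -/
theorem harmSum_nonneg (hq : χ ^ 2 = 1) (z : ℕ) : 0 ≤ harmSum χ z :=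
  Finset.sum_nonneg fun k _ => div_nonneg (coeff_nonneg χ hq k) (Nat.cast_nonneg k)

/-- `G` is non-decreasing. [folklore] -/
theorem harmSum_mono (hq : χ ^ 2 = 1) {y z : ℕ} (h : y ≤ z) : harmSum χ y ≤ harmSum χ z :=
  Finset.sum_le_sum_of_subset_of_nonneg (Finset.Ioc_subset_Ioc_right h)
    fun k _ _ => div_nonneg (coeff_nonneg χ hq k) (Nat.cast_nonneg k)

/-- `G(z) ≥ 1` for `z ≥ 1` (the term `k = 1`). [folklore] -/
theorem one_le_harmSum (hq : χ ^ 2 = 1) {z : ℕ} (hz : 1 ≤ z) : 1 ≤ harmSum χ z := by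
  refine le_trans ?_ (harmSum_mono χ hq hz)
  simp [harmSum]

/-! ### Elementary inequalities for `n^{-β} − (n+1)^{-β}` -/

omit χ in
/-- `0 ≤ n^{-β} − (n+1)^{-β}` for `n ≥ 1`, `β ≥ 0`. [folklore] -/
theorem rpow_neg_sub_succ_nonneg {n : ℕ} (hn : 1 ≤ n) {β : ℝ} (hβ : 0 ≤ β) :
    0 ≤ (n : ℝ) ^ (-β) - ((n + 1 : ℕ) : ℝ) ^ (-β) := by
  have hn0 : (0 : ℝ) < n := by exact_mod_cast hn
  rw [sub_nonneg]
  push_cast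
  exact Real.rpow_le_rpow_of_nonpos hn0 (by linarith) (by linarith)

omit χ in
/-- `|n^{-β} − (n+1)^{-β}| ≤ β n^{-β-1}` for `n ≥ 1`, `β > 0` (mean value theorem; the tree's complex
`MertensDictionary.norm_cpow_neg_sub_le` restricted to the real axis). [folklore] -/
theorem abs_rpow_neg_sub_succ_le {n : ℕ} (hn : 1 ≤ n) {β : ℝ} (hβ : 0 < β) :
    |(n : ℝ) ^ (-β) - ((n + 1 : ℕ) : ℝ) ^ (-β)| ≤ β * (n : ℝ) ^ (-β - 1) := by
  have h := MertensDictionary.norm_cpow_neg_sub_le (n := n) hn (s := (β : ℂ)) (by simpa using hβ)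
  have h1 : ((n : ℕ) : ℂ) ^ (-(β : ℂ)) = (((n : ℝ) ^ (-β) : ℝ) : ℂ) := by
    rw [Complex.ofReal_cpow (Nat.cast_nonneg n), Complex.ofReal_natCast, Complex.ofReal_neg]
  have h2 : ((n + 1 : ℕ) : ℂ) ^ (-(β : ℂ)) = ((((n + 1 : ℕ) : ℝ) ^ (-β) : ℝ) : ℂ) := by
    rw [Complex.ofReal_cpow (by positivity), Complex.ofReal_natCast, Complex.ofReal_neg]
  rw [h1, h2, ← Complex.ofReal_sub, Complex.norm_real, Real.norm_eq_abs, Complex.norm_real,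
    Real.norm_eq_abs, abs_of_pos hβ, Complex.ofReal_re] at h
  exact h

/-! ### Abel summation in range form (real) -/

omit χ in
/-- For real coefficients `c` with `C(k) = ∑_{0<j≤k} c_j`:
`∑_{n<M} C(n+1)((n+1)^{-β} − (n+2)^{-β}) = ∑_{0<k≤M} c_k k^{-β} − C(M)(M+1)^{-β}`. [cite: MontgomeryVaughan2007, §1.3 Thm. 1.3] -/
theorem sum_range_partial_mul_sub_rpow (c : ℕ → ℝ) (β : ℝ) (M : ℕ) :
    ∑ n ∈ range M, (∑ j ∈ Ioc 0 (n + 1), c j) *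
        (((n + 1 : ℕ) : ℝ) ^ (-β) - ((n + 1 + 1 : ℕ) : ℝ) ^ (-β)) =
      ∑ k ∈ Ioc 0 M, c k * (k : ℝ) ^ (-β) - (∑ j ∈ Ioc 0 M, c j) * ((M + 1 : ℕ) : ℝ) ^ (-β) := by
  have hre : ∑ k ∈ Ioc 0 M, (∑ j ∈ Ioc 0 k, c j) * ((k : ℝ) ^ (-β) - ((k + 1 : ℕ) : ℝ) ^ (-β)) =
      ∑ n ∈ range M, (∑ j ∈ Ioc 0 (n + 1), c j) *
        (((n + 1 : ℕ) : ℝ) ^ (-β) - ((n + 1 + 1 : ℕ) : ℝ) ^ (-β)) := by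
    induction M with
    | zero => simp
    | succ M ih => rw [Finset.sum_Ioc_succ_top (Nat.zero_le M), ih, Finset.sum_range_succ]
  have h := sum_Ioc_mul_eq_abel c (fun k => (k : ℝ) ^ (-β)) 0 M
  rw [← hre]
  simp only [Nat.cast_add, Nat.cast_one] at h ⊢
  rw [h]
  ring

/-! ### The tail `∑_{n > z} n^{-α-1} ≤ z^{-α}/α` -/

omit χ in
/-- Integral comparison: `∑_{n ≥ 0} (n + z + 1)^{-α-1} ≤ z^{-α}/α` for `α > 0`, `z ≥ 1`. [folklore] -/
theorem tsum_rpow_tail_le {α : ℝ} (hα : 0 < α) {z : ℕ} (hz : 1 ≤ z) :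
    ∑' n : ℕ, ((n + z + 1 : ℕ) : ℝ) ^ (-α - 1) ≤ (z : ℝ) ^ (-α) / α := by
  have hz0 : (0 : ℝ) < z := by exact_mod_cast hz
  refine Real.tsum_le_of_sum_range_le (fun n => by positivity) fun M => ?_
  -- `∑_{n<M} (n+z+1)^{-α-1} = ∑_{i ∈ Ico z (z+M)} (i+1)^{-α-1} ≤ ∫_z^{z+M} t^{-α-1} dt`
  have hanti : AntitoneOn (fun t : ℝ => t ^ (-α - 1)) (Set.Icc (z : ℝ) ((z + M : ℕ) : ℝ)) := by
    intro x hx y hy hxy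
    have hx0 : 0 < x := hz0.trans_le hx.1
    exact Real.rpow_le_rpow_of_nonpos hx0 hxy (by linarith)
  have hsum := AntitoneOn.sum_le_integral_Ico (Nat.le_add_right z M) hanti
  have hre : ∑ n ∈ range M, ((n + z + 1 : ℕ) : ℝ) ^ (-α - 1) =
      ∑ i ∈ Finset.Ico z (z + M), ((↑(i + 1) : ℝ)) ^ (-α - 1) := by
    rw [Finset.sum_Ico_eq_sum_range, Nat.add_sub_cancel_left]
    refine Finset.sum_congr rfl fun n _ => ?_
    congr 1; push_cast; ring
  rw [hre]
  refine hsum.trans ?_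
  have h0 : (0 : ℝ) ∉ Set.uIcc (z : ℝ) ((z + M : ℕ) : ℝ) := by
    rw [Set.uIcc_of_le (by exact_mod_cast Nat.le_add_right z M)]
    intro h
    exact absurd h.1 (not_le.mpr hz0)
  rw [integral_rpow (Or.inr ⟨by linarith, h0⟩)]
  have e : -α - 1 + 1 = -α := by ring
  rw [e]
  have h1 : 0 ≤ ((z + M : ℕ) : ℝ) ^ (-α) := by positivity
  have e2 : (((z + M : ℕ) : ℝ) ^ (-α) - (z : ℝ) ^ (-α)) / -α =
      ((z : ℝ) ^ (-α) - ((z + M : ℕ) : ℝ) ^ (-α)) / α := by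
    rw [div_neg, ← neg_div, neg_sub]
  rw [e2]
  exact div_le_div_of_nonneg_right (by linarith) hα.le

/-! ### The main inequality -/

/-- **`G(z) ≥ (2/5) L(1,χ)/δ − 13 q z^{-1/2}` at a real zero `1 − δ`.** Let `χ ≠ 1` be quadratic
mod `q`, `L(1 − δ, χ) = 0` with `0 < δ ≤ 1/10`, and `z ≥ 1` with `δ log z ≤ 1/2`. Then
`∑_{k ≤ z} r(k)/k ≥ (2/5) L(1,χ)/δ − 13 q z^{-1/2}`. [cite: Motohashi1979SiegelZeros, proof of the Theorem, (3)] -/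
theorem harmSum_ge [NeZero q] (hχ : χ ≠ 1) (hq : χ ^ 2 = 1) {δ : ℝ} (hδ : 0 < δ) (hδ1 : δ ≤ 1 / 10)
    (h0 : χ.LFunction ((1 - δ : ℝ) : ℂ) = 0) {z : ℕ} (hz : 1 ≤ z) (hδz : δ * Real.log z ≤ 1 / 2) :
    2 / 5 * (LOne χ / δ) - 13 * q * (z : ℝ) ^ (-(1 / 2 : ℝ)) ≤ harmSum χ z := by
  set β : ℝ := 1 - δ with hβdef
  have hβ : 1 / 2 < β := by rw [hβdef]; linarith
  have hβ1 : β < 1 := by rw [hβdef]; linarith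
  have hβ0 : 0 < β := by linarith
  have hz0 : (0 : ℝ) < z := by exact_mod_cast hz
  have hL := LOne_pos χ hχ hq
  obtain ⟨Ψ, hsum, hΨ⟩ := exists_hasSum_err_mul_ge χ hχ hq hβ hβ1 h0
  set t : ℕ → ℝ := fun n => err χ (n + 1) *
    (((n + 1 : ℕ) : ℝ) ^ (-β) - ((n + 1 + 1 : ℕ) : ℝ) ^ (-β)) with ht
  -- split `Ψ = head + tail`
  have hsplit : ∑ n ∈ range z, t n + ∑' n, t (n + z) = Ψ := by
    rw [← hsum.tsum_eq]; exact hsum.summable.sum_add_tsum_nat_add z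
  -- (1) the tail
  set α : ℝ := 1 / 2 - δ with hαdef
  have hα : 2 / 5 ≤ α := by rw [hαdef]; linarith
  have hα0 : 0 < α := by linarith
  have htail_term : ∀ n : ℕ, |t (n + z)| ≤ 5 * q * ((n + z + 1 : ℕ) : ℝ) ^ (-α - 1) := by
    intro n
    have hn1 : 1 ≤ n + z + 1 := by omega
    have hpos : (0 : ℝ) < ((n + z + 1 : ℕ) : ℝ) := by positivity
    simp only [ht]
    rw [abs_mul]
    have h1 := abs_err_le_rpow χ hχ hq (n + z + 1)
    have h2 := abs_rpow_neg_sub_succ_le (n := n + z + 1) hn1 hβ0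
    have h2' : |((n + z + 1 : ℕ) : ℝ) ^ (-β) - ((n + z + 1 + 1 : ℕ) : ℝ) ^ (-β)| ≤
        ((n + z + 1 : ℕ) : ℝ) ^ (-β - 1) := by
      refine h2.trans ?_
      have : 0 ≤ ((n + z + 1 : ℕ) : ℝ) ^ (-β - 1) := by positivity
      nlinarith
    calc |err χ (n + z + 1)| * |((n + z + 1 : ℕ) : ℝ) ^ (-β) - ((n + z + 1 + 1 : ℕ) : ℝ) ^ (-β)|
        ≤ (5 * q * ((n + z + 1 : ℕ) : ℝ) ^ (1 / 2 : ℝ)) * ((n + z + 1 : ℕ) : ℝ) ^ (-β - 1) :=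
          mul_le_mul h1 h2' (abs_nonneg _) (by positivity)
      _ = 5 * q * (((n + z + 1 : ℕ) : ℝ) ^ (1 / 2 : ℝ) * ((n + z + 1 : ℕ) : ℝ) ^ (-β - 1)) := by ring
      _ = 5 * q * ((n + z + 1 : ℕ) : ℝ) ^ (-α - 1) := by
          rw [← Real.rpow_add hpos]; congr 2; rw [hαdef, hβdef]; ring
  have htail_summable : Summable fun n => |t (n + z)| := by
    refine Summable.of_nonneg_of_le (fun n => abs_nonneg _) htail_term ?_
    refine Summable.mul_left _ ?_
    have := (summable_nat_add_iff (z + 1)).mpr (Real.summable_nat_rpow.mpr (by linarith : -α - 1 < -1))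
    refine this.congr fun n => ?_
    push_cast; ring_nf
  have htail : |∑' n, t (n + z)| ≤ 25 / 2 * q * ((z : ℝ) ^ (-α)) := by
    have h1 : |∑' n, t (n + z)| ≤ ∑' n, |t (n + z)| := by
      have := norm_tsum_le_tsum_norm (f := fun n => t (n + z)) (by simpa using htail_summable)
      simpa [Real.norm_eq_abs] using this
    have h2 : ∑' n, |t (n + z)| ≤ ∑' n : ℕ, 5 * q * ((n + z + 1 : ℕ) : ℝ) ^ (-α - 1) :=
      Summable.tsum_le_tsum htail_term htail_summable
        (((summable_nat_add_iff (z + 1)).mpr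
          (Real.summable_nat_rpow.mpr (by linarith : -α - 1 < -1))).congr
            (fun n => by push_cast; ring_nf) |>.mul_left _)
    have h3 : ∑' n : ℕ, 5 * q * ((n + z + 1 : ℕ) : ℝ) ^ (-α - 1) ≤ 5 * q * ((z : ℝ) ^ (-α) / α) := by
      rw [tsum_mul_left]
      exact mul_le_mul_of_nonneg_left (tsum_rpow_tail_le hα0 hz) (by positivity)
    have h4 : (z : ℝ) ^ (-α) / α ≤ 5 / 2 * (z : ℝ) ^ (-α) := by
      rw [div_le_iff₀ hα0]
      have : 0 ≤ (z : ℝ) ^ (-α) := by positivity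
      nlinarith
    have hq0 : (0 : ℝ) ≤ 5 * q := by positivity
    calc |∑' n, t (n + z)| ≤ 5 * q * ((z : ℝ) ^ (-α) / α) := h1.trans (h2.trans h3)
      _ ≤ 5 * q * (5 / 2 * (z : ℝ) ^ (-α)) := mul_le_mul_of_nonneg_left h4 hq0
      _ = 25 / 2 * q * (z : ℝ) ^ (-α) := by ring
  -- (2) the head
  have hhead : ∑ n ∈ range z, t n ≤ (z : ℝ) ^ δ * harmSum χ z := by
    have hsplit2 : ∀ n ∈ range z, t n =
        convSum χ (n + 1) * (((n + 1 : ℕ) : ℝ) ^ (-β) - ((n + 1 + 1 : ℕ) : ℝ) ^ (-β)) -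
          LOne χ * (((n + 1 : ℕ) : ℝ) *
            (((n + 1 : ℕ) : ℝ) ^ (-β) - ((n + 1 + 1 : ℕ) : ℝ) ^ (-β))) := by
      intro n _; simp only [ht, err]; ring
    rw [Finset.sum_congr rfl hsplit2, Finset.sum_sub_distrib, ← Finset.mul_sum]
    -- the `L₁`-part is `≥ 0`
    have hpos : 0 ≤ LOne χ * ∑ n ∈ range z, ((n + 1 : ℕ) : ℝ) *
        (((n + 1 : ℕ) : ℝ) ^ (-β) - ((n + 1 + 1 : ℕ) : ℝ) ^ (-β)) := by
      refine mul_nonneg hL.le (Finset.sum_nonneg fun n _ => mul_nonneg (by positivity) ?_)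
      exact rpow_neg_sub_succ_nonneg (by omega) hβ0.le
    -- Abel on the `S₀`-part
    have habel := sum_range_partial_mul_sub_rpow (fun k => coeff χ k) β z
    have hconv : ∀ n, ∑ j ∈ Ioc 0 n, coeff χ j = convSum χ n := fun n => rfl
    simp only [hconv] at habel
    rw [habel]
    have hdrop : 0 ≤ convSum χ z * ((z + 1 : ℕ) : ℝ) ^ (-β) :=
      mul_nonneg (convSum_nonneg χ hq z) (by positivity)
    have hmain : ∑ k ∈ Ioc 0 z, coeff χ k * (k : ℝ) ^ (-β) ≤ (z : ℝ) ^ δ * harmSum χ z := by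
      rw [harmSum, Finset.mul_sum]
      refine Finset.sum_le_sum fun k hk => ?_
      rw [Finset.mem_Ioc] at hk
      have hk0 : (0 : ℝ) < k := by exact_mod_cast hk.1
      have hkz : (k : ℝ) ≤ z := by exact_mod_cast hk.2
      have e : (k : ℝ) ^ (-β) = (k : ℝ) ^ δ * (1 / k) := by
        rw [one_div, ← Real.rpow_neg_one, ← Real.rpow_add hk0]; congr 1; rw [hβdef]; ring
      rw [e]
      have hck := coeff_nonneg χ hq k
      calc coeff χ k * ((k : ℝ) ^ δ * (1 / k)) = (k : ℝ) ^ δ * (coeff χ k / k) := by ring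
        _ ≤ (z : ℝ) ^ δ * (coeff χ k / k) := by
            refine mul_le_mul_of_nonneg_right (Real.rpow_le_rpow hk0.le hkz hδ.le) ?_
            exact div_nonneg hck hk0.le
    linarith
  -- (3) combine: `β L₁/δ ≤ Ψ ≤ z^δ G(z) + (25/2) q z^{-α}`
  have hΨ' : β / (1 - β) * LOne χ = β * (LOne χ / δ) := by
    rw [show 1 - β = δ by rw [hβdef]; ring]; ring
  have hzδ : (z : ℝ) ^ δ ≤ 2 := by
    -- `z^δ = exp(δ log z) ≤ exp(1/2) ≤ 2`
    rw [Real.rpow_def_of_pos hz0]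
    calc Real.exp (Real.log z * δ) ≤ Real.exp (1 / 2) :=
          Real.exp_le_exp.mpr (by rw [mul_comm]; exact hδz)
      _ ≤ 2 := by
          have := Real.exp_one_lt_d9
          have h := Real.exp_le_exp.mpr (show (1 / 2 : ℝ) ≤ 1 by norm_num)
          nlinarith [Real.add_one_le_exp (1 / 2 : ℝ), Real.exp_pos (1 / 2 : ℝ),
            sq_nonneg (Real.exp (1 / 2) - 2), Real.exp_add (1 / 2 : ℝ) (1 / 2)]
  have hzδ_inv : 1 / 2 ≤ ((z : ℝ) ^ δ)⁻¹ := by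
    -- `z^{-δ} = exp(−δ log z) ≥ 1 − δ log z ≥ 1/2`
    rw [← Real.rpow_neg hz0.le, Real.rpow_def_of_pos hz0]
    have := Real.add_one_le_exp (Real.log z * -δ)
    nlinarith
  have hzpow : (z : ℝ) ^ (-α) = (z : ℝ) ^ δ * (z : ℝ) ^ (-(1 / 2 : ℝ)) := by
    rw [← Real.rpow_add hz0]; congr 1; rw [hαdef]; ring
  have hzδ0 : 0 < (z : ℝ) ^ δ := Real.rpow_pos_of_pos hz0 δ
  have hzh0 : 0 ≤ (z : ℝ) ^ (-(1 / 2 : ℝ)) := by positivity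
  -- from `Ψ ≤ head + tail`
  have hup : β * (LOne χ / δ) ≤ (z : ℝ) ^ δ * harmSum χ z +
      25 / 2 * q * ((z : ℝ) ^ δ * (z : ℝ) ^ (-(1 / 2 : ℝ))) := by
    rw [← hΨ', ← hzpow]
    have := (abs_le.mp htail).2
    linarith [hΨ, hsplit, hhead]
  -- divide by `z^δ`
  have hzne : (z : ℝ) ^ δ ≠ 0 := hzδ0.ne'
  have hdiv : ((z : ℝ) ^ δ)⁻¹ * (β * (LOne χ / δ)) ≤
      harmSum χ z + 25 / 2 * q * (z : ℝ) ^ (-(1 / 2 : ℝ)) := by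
    have h1 := mul_le_mul_of_nonneg_left hup (inv_nonneg.mpr hzδ0.le)
    have e1 : ((z : ℝ) ^ δ)⁻¹ * ((z : ℝ) ^ δ * harmSum χ z +
        25 / 2 * q * ((z : ℝ) ^ δ * (z : ℝ) ^ (-(1 / 2 : ℝ)))) =
        harmSum χ z + 25 / 2 * q * (z : ℝ) ^ (-(1 / 2 : ℝ)) := by
      field_simp
    rwa [e1] at h1
  have hLδ : 0 < LOne χ / δ := div_pos hL hδ
  have hβ9 : 9 / 10 ≤ β := by rw [hβdef]; linarith
  have hprod : (1 / 2) * (9 / 10) ≤ ((z : ℝ) ^ δ)⁻¹ * β :=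
    mul_le_mul hzδ_inv hβ9 (by norm_num) (inv_nonneg.mpr hzδ0.le)
  have hkey : 2 / 5 * (LOne χ / δ) ≤ ((z : ℝ) ^ δ)⁻¹ * (β * (LOne χ / δ)) := by
    rw [← mul_assoc]
    exact mul_le_mul_of_nonneg_right (by linarith) hLδ.le
  have hq0 : (0 : ℝ) ≤ q := Nat.cast_nonneg q
  have hqz : 0 ≤ (q : ℝ) * (z : ℝ) ^ (-(1 / 2 : ℝ)) := mul_nonneg hq0 hzh0
  linarith

end Literature.NumberTheory.LFunctions.ZetaMul

end
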